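/-
Copyright (c) 2026 the pub-hodgecm-mathlib formalisation cell (harness21).  Prover seat hodgecm-mathlib-R90-C131-p05 (g2), R90-TF SLAB section S4
«Ch13.1–2» (base R90-C131), h413 = `stmt-HodgeConjecture-24833`; brick (A5) COVER-ε of the T-WIF road (S4 dealer K2E2-plan (g7), S4-R27 (3) and R90 bus
2026-09-05T00:45:42Z; HEADS sheet `R90/R90-C131-p03/g2/HEADS-TWIF-tube{,.v2}.md` §1 A5).
-/
import Summits.HodgeConjecture.HodgeConjecture.Theorems.R90S4EpsRegularHasNorm          -- ★ p863785 (this seat): (NORM-RAT) `exists_isEpsNormPair_splitFormGL`; brings `IsEpsRegularAt`, `IsEpsNormPair`, `epsLoc`, `GtLoc`, `splitFormGL`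
import Summits.HodgeConjecture.HodgeConjecture.Theorems.R90S4TwistedCartanNormFibres      -- ★ p863634 (R90-C131-p03): A3 `exists_isEpsConj_epsNorm_eq_coe_of_isEpsNormPair`, `mem_centralizer_of_epsNorm_eq_coe`, `isEpsRegularAt_of_epsNorm_eq_coe`
import HarnessLib

/-!
# R90-TF · S4 — (A5) COVER-ε `R90S4EpsTubeCover`: at a non-split place every ε-regular `δ ∈ G̃_v` is ε-conjugate INTO the torus `T̃` of some member `T` of a
# Cartan cover of `U(Φ₃)(L⁺_v)` (Rogawski 1990, §12.5 p. 186; §3.11 Prop. 3.11.1 pp. 34–35)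

Cell `hodgecm-mathlib`, crux H413 = `stmt-HodgeConjecture-24833`, route of record `HCCMUnconditional`; R90-TF section S4 (Rogawski Ch. 13.1–2, base `R90-C131`), seat
R90-C131-p05 (g2); brick (A5) COVER-ε of R90-C131-p03's T-WIF HEADS sheet (the ε-twisted Weyl integration formula (B1) behind the (W-NP) socket of S4 FILE C): the
covering step «every ε-regular `δ ∈ G̃_v` is ε-conjugate into `T̃^{ε-reg}` for some `T ∈ cartanAll`».  THEOREMS ONLY (no `def`, no `instance`, no notation, no named-fact
hypothesis, no `sorry`; default heartbeats); ★-only imports (this seat's (NORM-RAT) + p03's Layer A); lane `--supports stmt-HodgeConjecture-24833 --as helper` (count-neutral).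

THE MATHEMATICS.  `v` a finite place of `L⁺` NON-SPLIT in the CM field `L`, `G_v = U(Φ₃)(L⁺_v) ⊂ G̃_v = GL₃(L ⊗ L⁺_v)`, `ε = ε_v` the unitary twist, `N δ = δ ε(δ)`.
HYPOTHESIS-FIRST over a Cartan cover of `G_v` in the letters of ★ CARTAN-ALL `exists_cartanAll_weylShape` (its `hcov` clause VERBATIM: every regular `γ ∈ G_v` has
`Cent_{G_v}(γ) = x T x⁻¹` for some member `T` of the finite family `C` and some `x ∈ G_v` — the same binder p12's (T1) `isPlainWeylMeasure_plainCartanMeasure` carries, so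
the C ED. 6 PINS list is shared).  For an ε-REGULAR `δ` (`N δ` regular semisimple): (NORM-RAT) ★ `exists_isEpsNormPair_splitFormGL` gives `γ ∈ G_v` with `N δ ∼ γ` in `G̃_v`;
`γ` is regular (★ `isRegularElt_of_isConj`); `hcov` conjugates it into a member: `γ′ := x⁻¹ γ x ∈ T ∈ C`, still a norm of `δ` (norms form STABLE classes, ★
`IsEpsNormPair.of_isStablyConjGAt`); and p03's A3 ★ `exists_isEpsConj_epsNorm_eq_coe_of_isEpsNormPair` ε-conjugates `δ` to some `δ′` with `N δ′ = γ′` ON THE NOSE — so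
`δ′ ∈ T̃ := Cent_{G̃_v}(γ′)` (★ `mem_centralizer_of_epsNorm_eq_coe`) and `δ′` is ε-regular (★ `isEpsRegularAt_of_epsNorm_eq_coe`).  No new mathematics: a composition of
★ names, stated in Layer A's tokens (`IsEpsConj`, `epsNorm … = γ′.val`, `Subgroup.centralizer {γ′.val}`) so that M4 ∕ TUBE-EQ ∕ the (B1) assembly consume it by name.

* **`exists_isEpsConj_into_cartan_of_isEpsRegularAt`** (THE HEAD): `hns → ∀ C, hcov → ∀ δ, IsEpsRegularAt … δ → ∃ T ∈ C, ∃ γ′ ∈ T, γ′ regular ∧ ∃ δ′, δ ∼_ε δ′ ∧ N δ′ = γ′ ∧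
  δ′ ∈ Cent_{G̃_v}(γ′) ∧ δ′ ε-regular`.
* `exists_mem_cartan_isEpsNormPair_of_isEpsRegularAt` — the norm half alone (`∃ T ∈ C, ∃ γ′ ∈ T`, `γ′ ∈ 𝒩(δ)`), for consumers that only need the stable class.
WHY `hns`: (NORM-RAT) is the non-split statement (the field structure of `L ⊗ L⁺_v`).

HONEST LABEL: HC_CM is proved only modulo the 7 printed citations (2 remaining named inputs: hLiu418 = `stmt-HodgeConjecture-24832`, h413 = `stmt-HodgeConjecture-24833`) until
rung 0 closes; COVER-ε is ONE hypothesis of the (B1) assembly behind the OPEN (W-NP) socket — a ★ helper closes no socket; REL ≠ ★ ≠ BUILT; count-neutral.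

## References
* [Rogawski1990] J. D. Rogawski, *Automorphic Representations of Unitary Groups in Three Variables*, Ann. of Math. Stud. 123 (1990), §12.5 p. 186 (the twisted Weyl
  integration formula: «a set of representatives for the ε-conjugacy classes of ε-regular elements … `T̃`»), §3.11 Prop. 3.11.1 (a)–(c) pp. 34–35, §3.6 pp. 28–31.
-/

set_option autoImplicit false
-- the mandated namespace repeats the single-problem summit's segment (`HodgeConjecture.HodgeConjecture`)
set_option linter.dupNamespace false

noncomputable section

open NumberField IsDedekindDomain
open scoped MatrixGroups
open Literature.NumberTheory.Automorphic Literature.NumberTheory.Automorphic.UnitaryGroup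
open Literature.NumberTheory.Rogawski1990 Literature.NumberTheory.Rogawski1990.Ch4Sec10

namespace Summit.HodgeConjecture.HodgeConjecture.R90.S4

section CM

variable (L : Type) [Field L] [NumberField L] [IsCMField L] (v : HeightOneSpectrum (𝓞 ↥(maximalRealSubfield L)))

/-- **The norm of an ε-regular `δ` may be taken INSIDE A MEMBER OF ANY CARTAN COVER** (non-split `v`): given the `hcov` letter of ★ CARTAN-ALL («`Cent_{G_v}(γ) = x T x⁻¹`
for every regular `γ ∈ G_v`»), every ε-regular `δ ∈ G̃_v` has a norm `γ′ ∈ T` for some member `T ∈ C`, `γ′` regular — (NORM-RAT) ★ `exists_isEpsNormPair_splitFormGL`, regularity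
of the norm (★ `isRegularElt_of_isConj`: `N δ ∼ γ`), conjugation `γ′ = x⁻¹ γ x ∈ T` by `hcov` at `g := γ`, and `𝒩(δ)` is a union of stable classes (★ `IsEpsNormPair.of_isStablyConjGAt`).
[cite: Rogawski1990, §3.11 Prop. 3.11.1 (a)(c) p. 34; §12.5 p. 186] -/
theorem exists_mem_cartan_isEpsNormPair_of_isEpsRegularAt (hns : ∀ w : PlacesOver L v, IsCMField.complexConj L • w.1 = w.1)
    (C : Finset (Subgroup ((UnitaryGroup.cmDatum L 3 (splitFormGL L : Matrix (Fin 3) (Fin 3) L)).Local v)))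
    (hcov : ∀ γ : (UnitaryGroup.cmDatum L 3 (splitFormGL L : Matrix (Fin 3) (Fin 3) L)).Local v, IsRegularElt (γ.val : GL (Fin 3) (LocalRing L v)) →
      ∃ T ∈ C, ∃ x : (UnitaryGroup.cmDatum L 3 (splitFormGL L : Matrix (Fin 3) (Fin 3) L)).Local v,
        ∀ g : (UnitaryGroup.cmDatum L 3 (splitFormGL L : Matrix (Fin 3) (Fin 3) L)).Local v,
          g ∈ Subgroup.centralizer ({γ} : Set ((UnitaryGroup.cmDatum L 3 (splitFormGL L : Matrix (Fin 3) (Fin 3) L)).Local v)) ↔ x⁻¹ * g * x ∈ T)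
    (δ : GtLoc L v) (hδ : IsEpsRegularAt L (splitFormGL L) v δ) :
    ∃ T ∈ C, ∃ γ' : (UnitaryGroup.cmDatum L 3 (splitFormGL L : Matrix (Fin 3) (Fin 3) L)).Local v,
      γ' ∈ T ∧ IsRegularElt (γ'.val : GtLoc L v) ∧ IsEpsNormPair L (splitFormGL L) v δ γ' := by
  -- a norm `γ` of `δ` in `G_v`, regular because `N δ ∼ γ` is
  obtain ⟨γ, hγ⟩ := exists_isEpsNormPair_splitFormGL L v hns δ
  have hγreg : IsRegularElt (γ.val : GtLoc L v) :=
    isRegularElt_of_isConj ((isEpsNormPair_iff δ γ).1 hγ) ((isEpsRegularAt_iff L (splitFormGL L) v δ).1 hδ)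
  -- the cover: `Cent(γ) = x T x⁻¹`, so `γ′ := x⁻¹ γ x ∈ T`
  obtain ⟨T, hTC, x, hx⟩ := hcov γ hγreg
  have hγ'T : x⁻¹ * γ * x ∈ T := (hx γ).1 (Subgroup.mem_centralizer_singleton_iff.2 rfl)
  refine ⟨T, hTC, x⁻¹ * γ * x, hγ'T, ?_, ?_⟩
  · -- regularity is a class function
    have hval : ((x⁻¹ * γ * x : (UnitaryGroup.cmDatum L 3 (splitFormGL L : Matrix (Fin 3) (Fin 3) L)).Local v).val : GtLoc L v) =
        (x.val : GtLoc L v)⁻¹ * γ.val * ((x.val : GtLoc L v)⁻¹)⁻¹ := by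
      rw [inv_inv]
      rfl
    rw [hval]
    exact (isRegularElt_conj_iff _ _).2 hγreg
  · -- `𝒩(δ)` is a union of stable classes: `γ ∼ x⁻¹ γ x` in `G̃_v`
    refine hγ.of_isStablyConjGAt ?_
    rw [isStablyConjGAt_iff]
    refine isConj_iff.2 ⟨(x.val : GtLoc L v)⁻¹, ?_⟩
    change (x.val : GtLoc L v)⁻¹ * γ.val * ((x.val : GtLoc L v)⁻¹)⁻¹ =
      ((x⁻¹ * γ * x : (UnitaryGroup.cmDatum L 3 (splitFormGL L : Matrix (Fin 3) (Fin 3) L)).Local v).val : GtLoc L v)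
    rw [inv_inv]
    rfl

/-- **(A5) COVER-ε — every ε-REGULAR `δ ∈ G̃_v` is ε-conjugate INTO THE TORUS `T̃ = Cent_{G̃_v}(γ′)` of a member `T ∋ γ′` of the Cartan cover, with norm `γ′` ON THE NOSE** (non-split
`v`; hypothesis-first over ★ CARTAN-ALL's `hcov` letter): `∃ T ∈ C, ∃ γ′ ∈ T` regular, `∃ δ′`, `δ ∼_ε δ′` (★ `IsEpsConj (epsLoc …)`), `N δ′ = γ′` (★ `epsNorm`), `δ′ ∈ Cent_{G̃_v}(γ′)`
and `δ′` ε-regular — the previous theorem followed by R90-C131-p03's A3 ★ `exists_isEpsConj_epsNorm_eq_coe_of_isEpsNormPair` (conjugate `N δ` onto `γ′`, take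
`δ′ = y δ ε(y)⁻¹`), ★ `mem_centralizer_of_epsNorm_eq_coe` and ★ `isEpsRegularAt_of_epsNorm_eq_coe`.  Print: «Let `{T}` be a set of representatives for the conjugacy classes of
Cartan subgroups … every ε-regular ε-semisimple class meets some `T̃`» (the covering half of the twisted Weyl integration formula, p. 186).  Stated in Layer A's tokens so that
M4 ∕ TUBE-EQ ∕ the (B1) assembly `isTwistedWeylMeasure_stableCartanMeasure_of_twistedTubeJacobians` consume it by name.
[cite: Rogawski1990, §12.5 p. 186; §3.11 Prop. 3.11.1 (b)(c) pp. 34–35] -/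
theorem exists_isEpsConj_into_cartan_of_isEpsRegularAt (hns : ∀ w : PlacesOver L v, IsCMField.complexConj L • w.1 = w.1)
    (C : Finset (Subgroup ((UnitaryGroup.cmDatum L 3 (splitFormGL L : Matrix (Fin 3) (Fin 3) L)).Local v)))
    (hcov : ∀ γ : (UnitaryGroup.cmDatum L 3 (splitFormGL L : Matrix (Fin 3) (Fin 3) L)).Local v, IsRegularElt (γ.val : GL (Fin 3) (LocalRing L v)) →
      ∃ T ∈ C, ∃ x : (UnitaryGroup.cmDatum L 3 (splitFormGL L : Matrix (Fin 3) (Fin 3) L)).Local v,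
        ∀ g : (UnitaryGroup.cmDatum L 3 (splitFormGL L : Matrix (Fin 3) (Fin 3) L)).Local v,
          g ∈ Subgroup.centralizer ({γ} : Set ((UnitaryGroup.cmDatum L 3 (splitFormGL L : Matrix (Fin 3) (Fin 3) L)).Local v)) ↔ x⁻¹ * g * x ∈ T)
    (δ : GtLoc L v) (hδ : IsEpsRegularAt L (splitFormGL L) v δ) :
    ∃ T ∈ C, ∃ γ' : (UnitaryGroup.cmDatum L 3 (splitFormGL L : Matrix (Fin 3) (Fin 3) L)).Local v,
      γ' ∈ T ∧ IsRegularElt (γ'.val : GtLoc L v) ∧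
        ∃ δ' : GtLoc L v, IsEpsConj (epsLoc L (splitFormGL L) v) δ δ' ∧
          epsNorm (epsLoc L (splitFormGL L) v) δ' = γ'.val ∧
          δ' ∈ Subgroup.centralizer ({(γ'.val : GtLoc L v)} : Set (GtLoc L v)) ∧
          IsEpsRegularAt L (splitFormGL L) v δ' := by
  obtain ⟨T, hTC, γ', hγ'T, hγ'reg, hN⟩ := exists_mem_cartan_isEpsNormPair_of_isEpsRegularAt L v hns C hcov δ hδ
  obtain ⟨δ', hconj, hNδ'⟩ := exists_isEpsConj_epsNorm_eq_coe_of_isEpsNormPair (splitFormGL_isHermitian L) hN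
  exact ⟨T, hTC, γ', hγ'T, hγ'reg, δ', hconj, hNδ', mem_centralizer_of_epsNorm_eq_coe (splitFormGL_isHermitian L) hNδ',
    isEpsRegularAt_of_epsNorm_eq_coe hγ'reg hNδ'⟩

end CM

end Summit.HodgeConjecture.HodgeConjecture.R90.S4

end
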